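/-
Copyright: the b2b-balaban T⁴-continuum CRUX team, row NE7b leaf lineage `t4-ne7b-formalise-leaf-06` (gen 156). Project licence.
-/
import Summits.QuantumFields.BalabanUV.T4Continuum.Spine.NE7b.HardStepUnitStep
import Summits.QuantumFields.BalabanUV.T4Continuum.Spine.NE7b.HardStepRescalingLetters
import Summits.QuantumFields.BalabanUV.T4Continuum.Spine.NE7b.TransportedFormCoercivity
import Summits.QuantumFields.BalabanUV.T4Continuum.Spine.NE7b.HardStepUnitBox

/-!
# THE HARD-STEP TOWER RE-ENTERS IN COERCIVITY UNITS: HSRL's rescaled letters, restricted to a closed ball, are the input of the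
# NORMALISED inductive step `inductiveStep_unit` at the next scale — the next action is re-measured in units of the next kernel
# coercivity `m₂`, so the equivalence letter is the dimensionless `(1 + t²H∕m₂)‖M₂‖ + 1 ≤ N₂` and the modulus letter the relative
# `|t|³Λ₃·r₂ ≤ c₂·m₂` (row NE7b, node U5c; assembly of this lineage's `HardStepUnitStep` (HSUS) and `HardStepRescalingLetters`
# (HSRL) BY NAME — the unit twin of `HardStepTowerTwoSteps` §1; [folklore])

Cell `pub-balaban`, sub-cell `t4`, spine estimate NE7b (`T4WeightBudget.RelWeightBound`; the cell's OWN estimate — NOT PRINTED in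
[Bałaban 1983–89], NOT PROVED).  Crux-route work under `Spine/NE7b/` by a row leaf (`t4-ne7b-formalise-leaf-06` gen 156) in the
hard-step cell under FREEZE (0)'s crux-prover clause; NOTHING of Bałaban's is named as a Lean object, valued or asserted; no
`T4Continuum/Support` leaf typed; no `def`; zero `sorry`.  Imports: HSUS (`inductiveStep_unit`; through it HSIS and ASL) and HSRL
(`rescaled_letters`) — both this lineage's — and leaf-03's `TransportedFormCoercivity` (TFC, §2's next coercivity).

WHY.  HSTT §1 (`nextStep_of_letters`) showed the re-entry in shape with the UN-normalised step, whose equivalence letter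
`(1 + t²H∕m₂)‖M₂‖ + m₂⁻¹ ≤ N₂` carries the dimensional summand `m₂⁻¹` (F634) and whose box (HSTB) needed the radius letter `|t|K₁ < 1`
that block-average kinematics forbid (leaf-01's HRO, the pricing desk's F660).  With the step normalised at EVERY scale by its own
kernel coercivity (HSUS), the side conditions are those of the unit box (HSUB): `(1 + t²H∕m₂)‖M₂‖ + 1 ≤ N₂` — `t`-free once
`m₂ = t²γ∕d²` — and `|t|³Λ₃r₂ ≤ c₂·m₂` at a FLOATING radius `r₂ < ρ∕|t|` (no `|t|K₁ < 1`).  This file is that one theorem; the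
two-step composition with HSUB's box is the successor junction.

WHAT IS PROVED ([folklore] assembly; `E`, `F` real Hilbert spaces (HSIS's fine-space requirement at the two scales), `F₂` real normed):
* **`nextStep_of_letters_unit`** — HSRL's input letters for `(σ₁, U, U″)` on `ball w₀ ρ` (constants `K₁, Λ₁, G₁, Λ₂, H, Λ₃`, `DU(w₀) = 0`),
  `t ≠ 0`, scale-`(k+1)` data `D₂`, right inverse `M₂`, kernel coercivity `m₂ > 0` of `t² • U″(w₀)` on `ker D₂`, `N₂, c₂ : ℝ≥0` with
  `c₂ < N₂⁻¹` and the DIMENSIONLESS letter `(1 + t²H∕m₂)‖M₂‖ + 1 ≤ N₂`, a radius `0 < r₂ < ρ∕|t|` with the RELATIVE modulus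
  `|t|³Λ₃·r₂ ≤ c₂·m₂` ⟹ `inductiveStep_unit`'s conclusion at scale `k+1`: a chart `σ₂` with the block (a)–(d) for the renormalised
  rescaled action `m₂⁻¹ • (U ∘ (t•))`, Hessian `m₂⁻¹ • t² • U″(t•·)`, sizes `(|t|³Λ₃, t²H, |t|G₁)∕m₂`, chart constant `(N₂⁻¹ − c₂)⁻¹`.

* §2 **`twoSteps_unit`** — THE COMPOSITION WITH `t`-FREE SIDE CONDITIONS: `inductiveStep_unit`'s scale-`k` hypotheses VERBATIM, `t ≠ 0`,
  the scale-`(k+1)` blocking `D₂` ∕ `M₂`, TFC's two letters (`m₂` on `ker (D₂∘D)` for `V″(δ₀)`, `‖Dv‖ ≤ d‖v‖`), `c₂ < N₂⁻¹`, a radius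
  fraction `0 < λ < 1`, and the unit box's two side conditions `(1 + (B∕m)K₁²d²∕(m₂∕m))‖M₂‖ + 1 ≤ N₂`,
  `λ·Λ₃·(K₁⁻¹r)·d²∕(m₂∕m) ≤ c₂` — NO `t` IN EITHER — ⟹ `σ₁`, `σ₂`, `σ₂`'s chart letters at radius `r₂ = λK₁⁻¹r∕|t|`, the
  first-order letter and FULL criticality of `((t²(m₂∕m)∕d²)⁻¹ • ((m⁻¹ • V) ∘ σ₁ ∘ (t•))) ∘ σ₂` (TFC's
  `kerCoercive_bilinearComp_div` BY NAME for the next coercivity; `modulus_side_of_unit` ∕ `radius_side_of_unit` ∕ ASL's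
  `nextHessianSize_unit` turn the `t`-free conditions into §1's shapes).

* §3 **`twoSteps_unit_of_box`** — THE SAME `(N, c)` SERVE: §2 with `(N₂, c₂) := (N, c)` and the side conditions replaced by HSUB's box
  (`Θ := K₁²d²∕γ ≤ 1`, `λ(1 + 2(B∕m)K₁)Θ ≤ 1`, carried `(1 + B∕m)μ + 1 ≤ N` with `‖M₂‖ ≤ μ`, carried `(M₃∕m)r ≤ c`) — HSUB's
  `nextXB_le` ∕ `nextEquiv_le` ∕ `nextModulusLetter_le` BY NAME + `modulus_hyp_of_box`.  No `t` but `t ≠ 0`.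

NOT HERE (honest): the box BY VALUE — HSUB §3b records that `Θ ≤ 1` forces `γ = m₂∕m ≥ 1` while the free field has `γ = L⁻²`, and
HSUB v1.1 §6 (the pricing desk's located price) that §3's binders THEMSELVES force `Θ ≥ 4` on every non-trivial blocking: §3 is TRUE AND
EMPTY while `K₁` is fed by AHE's global equivalence bound — the located debts are the size letter (this lineage's
`…TransportedHessianEnergyCeiling`) and the CHART letter (a chart constant from the actual inverse's letters, print's (α)); anything
of Bałaban's ((A3) ∕ (A1c), NC-NE7b-α UNRULED).  BY-NAME EFFECT ON THE WALL: NONE.  NE7b NOT PRINTED ∕ NOT PROVED; spine PROVED 0∕9;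
rung (B)+1 on a FINITE torus — NOT infinite volume, NOT the mass gap, NOT Clay.  HONEST DEPENDENCY: continuum YM on T⁴ ⇐ BetaPertH ∧
nine spine estimates (0∕9 proved); BetaPertH ⇐ (D1) ∧ (D4) ∧ CAP+tail; G-an2-4 gates asym, D1 and NE2∕3∕4.
-/

set_option autoImplicit false

noncomputable section

namespace Summit.QuantumFields.BalabanUV.T4Continuum.NE7b.HardStepUnitTower

open Set Filter Topology Function Metric
open scoped NNReal
open Summit.QuantumFields.BalabanUV.T4Continuum.NE7b

variable {E F F₂ : Type*} [NormedAddCommGroup E] [InnerProductSpace ℝ E]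
  [NormedAddCommGroup F] [InnerProductSpace ℝ F] [CompleteSpace F] [Nontrivial F]
  [NormedAddCommGroup F₂] [NormedSpace ℝ F₂]

/-- **THE RE-ENTRY IN COERCIVITY UNITS.**  HSRL's input letters for `(σ₁, U, U″)` on `ball w₀ ρ`, a homothety `t ≠ 0`, and the
scale-`(k+1)` data (`D₂`, `M₂`, `m₂`-coercivity of `t² • U″(w₀)` on `ker D₂`, `N₂`, `c₂ < N₂⁻¹`, the dimensionless
`(1 + t²H∕m₂)‖M₂‖ + 1 ≤ N₂`, `0 < r₂ < ρ∕|t|`, the relative `|t|³Λ₃·r₂ ≤ c₂·m₂`, `0 ≤ Λ₃`) ⟹ `inductiveStep_unit`'s conclusion at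
scale `k+1` for the rescaled action `U ∘ (t•)` renormalised by `m₂⁻¹`. [folklore] -/
theorem nextStep_of_letters_unit {σ₁ : F → E} {U : F → ℝ} {U'' : F → F →L[ℝ] F →L[ℝ] ℝ} (D : E →L[ℝ] F) {S : Set E} {w₀ : F}
    {ρ K₁ Λ₁ G₁ Λ₂ H Λ₃ t : ℝ} (ht : t ≠ 0) (hρ : 0 < ρ)
    (hσ : ∀ w ∈ ball w₀ ρ, σ₁ w ∈ S ∧ DifferentiableAt ℝ σ₁ w ∧ (∀ k, D (fderiv ℝ σ₁ w k) = k) ∧ ‖fderiv ℝ σ₁ w‖ ≤ K₁)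
    (hσ₂ : ∀ w ∈ ball w₀ ρ, ∀ w' ∈ ball w₀ ρ,
      ‖σ₁ w - σ₁ w'‖ ≤ K₁ * ‖w - w'‖ ∧ ‖fderiv ℝ σ₁ w - fderiv ℝ σ₁ w'‖ ≤ Λ₁ * ‖w - w'‖)
    (hU : ∀ w ∈ ball w₀ ρ, DifferentiableAt ℝ U w ∧ ‖fderiv ℝ U w‖ ≤ G₁)
    (hU₂ : ∀ w ∈ ball w₀ ρ, ∀ w' ∈ ball w₀ ρ, ‖fderiv ℝ U w - fderiv ℝ U w'‖ ≤ Λ₂ * ‖w - w'‖)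
    (hU'' : ∀ w ∈ ball w₀ ρ, HasFDerivAt (fderiv ℝ U) (U'' w) w ∧ ‖fderiv ℝ (fderiv ℝ U) w‖ ≤ H)
    (hU''₂ : ∀ w ∈ ball w₀ ρ, ∀ w' ∈ ball w₀ ρ,
      ‖fderiv ℝ (fderiv ℝ U) w - fderiv ℝ (fderiv ℝ U) w'‖ ≤ Λ₃ * ‖w - w'‖)
    (hcrit : fderiv ℝ U w₀ = 0) (hΛ₃ : 0 ≤ Λ₃)
    -- scale k+1
    (D₂ : F →L[ℝ] F₂) (M₂ : F₂ →L[ℝ] F) (hM₂ : ∀ u, D₂ (M₂ u) = u) {m₂ : ℝ} (hm₂ : 0 < m₂)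
    (hco₂ : ∀ κ, D₂ κ = 0 → m₂ * ‖κ‖ ^ 2 ≤ ((t ^ 2) • U'' w₀) κ κ)
    {N₂ c₂ : ℝ≥0} (hN₂ : (1 + t ^ 2 * H / m₂) * ‖M₂‖ + 1 ≤ (N₂ : ℝ)) (hc₂ : c₂ < N₂⁻¹)
    {r₂ : ℝ} (hr₂ : 0 < r₂) (hr₂ρ : r₂ < ρ / |t|) (hc₂r : |t| ^ 3 * Λ₃ * r₂ ≤ (c₂ : ℝ) * m₂) :
    ∃ σ₂ : F₂ → F, σ₂ (D₂ (t⁻¹ • w₀)) = t⁻¹ • w₀ ∧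
      -- (a) the branch letters
      (∀ u ∈ ball (D₂ (t⁻¹ • w₀)) (((N₂ : ℝ)⁻¹ - c₂) * r₂), σ₂ u ∈ closedBall (t⁻¹ • w₀) r₂ ∧ DifferentiableAt ℝ σ₂ u ∧
        (∀ k, D₂ (fderiv ℝ σ₂ u k) = k) ∧ ‖fderiv ℝ σ₂ u‖ ≤ ((N₂ : ℝ)⁻¹ - c₂)⁻¹) ∧
      (∀ u ∈ ball (D₂ (t⁻¹ • w₀)) (((N₂ : ℝ)⁻¹ - c₂) * r₂), ∀ u' ∈ ball (D₂ (t⁻¹ • w₀)) (((N₂ : ℝ)⁻¹ - c₂) * r₂),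
        ‖σ₂ u - σ₂ u'‖ ≤ ((N₂ : ℝ)⁻¹ - c₂)⁻¹ * ‖u - u'‖ ∧
        ‖fderiv ℝ σ₂ u - fderiv ℝ σ₂ u'‖ ≤ (((N₂ : ℝ)⁻¹ - c₂)⁻¹) ^ 2 * (|t| ^ 3 * Λ₃ / m₂) * ((N₂ : ℝ)⁻¹ - c₂)⁻¹ * ‖u - u'‖) ∧
      -- (b) the first-order letters of `(m₂⁻¹ • (fun v : F => U (t • v))) ∘ σ₂`
      (∀ u ∈ ball (D₂ (t⁻¹ • w₀)) (((N₂ : ℝ)⁻¹ - c₂) * r₂), DifferentiableAt ℝ ((m₂⁻¹ • (fun v : F => U (t • v))) ∘ σ₂) u ∧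
        ‖fderiv ℝ ((m₂⁻¹ • (fun v : F => U (t • v))) ∘ σ₂) u‖ ≤ |t| * G₁ / m₂ * ((N₂ : ℝ)⁻¹ - c₂)⁻¹) ∧
      (∀ u ∈ ball (D₂ (t⁻¹ • w₀)) (((N₂ : ℝ)⁻¹ - c₂) * r₂), ∀ u' ∈ ball (D₂ (t⁻¹ • w₀)) (((N₂ : ℝ)⁻¹ - c₂) * r₂),
        ‖fderiv ℝ ((m₂⁻¹ • (fun v : F => U (t • v))) ∘ σ₂) u - fderiv ℝ ((m₂⁻¹ • (fun v : F => U (t • v))) ∘ σ₂) u'‖ ≤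
          (t ^ 2 * H / m₂ * ((N₂ : ℝ)⁻¹ - c₂)⁻¹ * ((N₂ : ℝ)⁻¹ - c₂)⁻¹ +
            |t| * G₁ / m₂ * ((((N₂ : ℝ)⁻¹ - c₂)⁻¹) ^ 2 * (|t| ^ 3 * Λ₃ / m₂) * ((N₂ : ℝ)⁻¹ - c₂)⁻¹)) * ‖u - u'‖) ∧
      -- (c) the Hessian letters of `(m₂⁻¹ • (fun v : F => U (t • v))) ∘ σ₂`
      (∀ u ∈ ball (D₂ (t⁻¹ • w₀)) (((N₂ : ℝ)⁻¹ - c₂) * r₂),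
        HasFDerivAt (fderiv ℝ ((m₂⁻¹ • (fun v : F => U (t • v))) ∘ σ₂)) ((m₂⁻¹ • ((t ^ 2) • U'' (t • σ₂ u))).bilinearComp (fderiv ℝ σ₂ u) (fderiv ℝ σ₂ u)) u ∧
        ‖fderiv ℝ (fderiv ℝ ((m₂⁻¹ • (fun v : F => U (t • v))) ∘ σ₂)) u‖ ≤ t ^ 2 * H / m₂ * (((N₂ : ℝ)⁻¹ - c₂)⁻¹) ^ 2) ∧
      (∀ u ∈ ball (D₂ (t⁻¹ • w₀)) (((N₂ : ℝ)⁻¹ - c₂) * r₂), ∀ u' ∈ ball (D₂ (t⁻¹ • w₀)) (((N₂ : ℝ)⁻¹ - c₂) * r₂),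
        ‖fderiv ℝ (fderiv ℝ ((m₂⁻¹ • (fun v : F => U (t • v))) ∘ σ₂)) u - fderiv ℝ (fderiv ℝ ((m₂⁻¹ • (fun v : F => U (t • v))) ∘ σ₂)) u'‖ ≤
          |t| ^ 3 * Λ₃ / m₂ * ((N₂ : ℝ)⁻¹ - c₂)⁻¹ * (((N₂ : ℝ)⁻¹ - c₂)⁻¹) ^ 2 * (1 + 2 * (t ^ 2 * H / m₂) * ((N₂ : ℝ)⁻¹ - c₂)⁻¹) * ‖u - u'‖) ∧
      -- (d) FULL criticality at the next centre
      fderiv ℝ ((m₂⁻¹ • (fun v : F => U (t • v))) ∘ σ₂) (D₂ (t⁻¹ • w₀)) = 0 := by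
  have ht' : 0 < |t| := abs_pos.mpr ht
  -- HSRL: every letter rescaled, on `ball (t⁻¹ • w₀) (ρ / |t|)`
  obtain ⟨-, h1, -, h3, h4, h5, h6, h7⟩ :=
    HardStepRescalingLetters.rescaled_letters (U := U) D ht hρ hσ hσ₂ hU hU₂ hU'' hU''₂ hcrit
  -- the closed ball of radius r₂ sits inside
  have sub : closedBall (t⁻¹ • w₀) r₂ ⊆ ball (t⁻¹ • w₀) (ρ / |t|) := closedBall_subset_ball hr₂ρ
  have h0 : t⁻¹ • w₀ ∈ ball (t⁻¹ • w₀) (ρ / |t|) := mem_ball_self (div_pos hρ ht')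
  -- on the ball, the second derivative IS the displayed Hessian
  have e2 : ∀ v ∈ ball (t⁻¹ • w₀) (ρ / |t|),
      fderiv ℝ (fderiv ℝ (fun v : F => U (t • v))) v = (t ^ 2) • U'' (t • v) := fun v hv => (h5 v hv).1.fderiv
  -- the centre's Hessian is `t² • U″ w₀`
  have ec : (t ^ 2) • U'' (t • (t⁻¹ • w₀)) = (t ^ 2) • U'' w₀ := by rw [smul_inv_smul₀ ht]
  -- the dimensionless equivalence letter from the monotone form
  have hB0 : ‖(t ^ 2) • U'' (t • (t⁻¹ • w₀))‖ ≤ t ^ 2 * H := by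
    rw [← e2 _ h0]; exact (h5 _ h0).2
  have hN₂' : (1 + ‖(fun v : F => (t ^ 2) • U'' (t • v)) (t⁻¹ • w₀)‖ / m₂) * ‖M₂‖ + 1 ≤ (N₂ : ℝ) := by
    refine le_trans ?_ hN₂
    have h1' : ‖(fun v : F => (t ^ 2) • U'' (t • v)) (t⁻¹ • w₀)‖ / m₂ ≤ t ^ 2 * H / m₂ :=
      div_le_div_of_nonneg_right hB0 hm₂.le
    have h2' : 0 ≤ ‖M₂‖ := norm_nonneg _
    nlinarith
  have hco₂' : ∀ κ, D₂ κ = 0 → m₂ * ‖κ‖ ^ 2 ≤ (fun v : F => (t ^ 2) • U'' (t • v)) (t⁻¹ • w₀) κ κ := by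
    intro κ hκ
    have := hco₂ κ hκ
    simpa only [ec] using this
  have hΛ' : 0 ≤ |t| ^ 3 * Λ₃ := mul_nonneg (pow_nonneg ht'.le 3) hΛ₃
  -- the scale-(k+1) letters in `inductiveStep_unit`'s binder shapes
  have hVd₂ : ∀ x ∈ closedBall (t⁻¹ • w₀) r₂, DifferentiableAt ℝ (fun v : F => U (t • v)) x :=
    fun x hx => (h3 x (sub hx)).1
  have hV₂ : ∀ x ∈ closedBall (t⁻¹ • w₀) r₂,
      HasFDerivAt (fderiv ℝ (fun v : F => U (t • v))) ((fun v : F => (t ^ 2) • U'' (t • v)) x) x :=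
    fun x hx => (h5 x (sub hx)).1
  have hVc₂ : ∀ x ∈ closedBall (t⁻¹ • w₀) r₂,
      ‖(fun v : F => (t ^ 2) • U'' (t • v)) x - (fun v : F => (t ^ 2) • U'' (t • v)) (t⁻¹ • w₀)‖ ≤ (c₂ : ℝ) * m₂ := by
    intro x hx
    show ‖(t ^ 2) • U'' (t • x) - (t ^ 2) • U'' (t • (t⁻¹ • w₀))‖ ≤ (c₂ : ℝ) * m₂
    rw [← e2 x (sub hx), ← e2 _ h0]
    have hx' : ‖x - t⁻¹ • w₀‖ ≤ r₂ := by rwa [mem_closedBall, dist_eq_norm] at hx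
    calc ‖fderiv ℝ (fderiv ℝ (fun v : F => U (t • v))) x - fderiv ℝ (fderiv ℝ (fun v : F => U (t • v))) (t⁻¹ • w₀)‖
        ≤ |t| ^ 3 * Λ₃ * ‖x - t⁻¹ • w₀‖ := h6 x (sub hx) _ h0
      _ ≤ |t| ^ 3 * Λ₃ * r₂ := mul_le_mul_of_nonneg_left hx' hΛ'
      _ ≤ (c₂ : ℝ) * m₂ := hc₂r
  have hlip₂ : ∀ x ∈ closedBall (t⁻¹ • w₀) r₂, ∀ x' ∈ closedBall (t⁻¹ • w₀) r₂,
      ‖(fun v : F => (t ^ 2) • U'' (t • v)) x - (fun v : F => (t ^ 2) • U'' (t • v)) x'‖ ≤ |t| ^ 3 * Λ₃ * ‖x - x'‖ := by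
    intro x hx x' hx'
    show ‖(t ^ 2) • U'' (t • x) - (t ^ 2) • U'' (t • x')‖ ≤ |t| ^ 3 * Λ₃ * ‖x - x'‖
    rw [← e2 x (sub hx), ← e2 x' (sub hx')]
    exact h6 x (sub hx) x' (sub hx')
  have hVB₂ : ∀ x ∈ closedBall (t⁻¹ • w₀) r₂, ‖(fun v : F => (t ^ 2) • U'' (t • v)) x‖ ≤ t ^ 2 * H := by
    intro x hx
    show ‖(t ^ 2) • U'' (t • x)‖ ≤ t ^ 2 * H
    rw [← e2 x (sub hx)]
    exact (h5 x (sub hx)).2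
  have hVG₂ : ∀ x ∈ closedBall (t⁻¹ • w₀) r₂, ‖fderiv ℝ (fun v : F => U (t • v)) x‖ ≤ |t| * G₁ :=
    fun x hx => (h3 x (sub hx)).2
  exact HardStepUnitStep.inductiveStep_unit (V := fun v : F => U (t • v)) (V'' := fun v : F => (t ^ 2) • U'' (t • v))
    (δ₀ := t⁻¹ • w₀) D₂ M₂ hM₂ hm₂ hco₂' hN₂' hc₂ hr₂ hVd₂ hV₂ hVc₂ h7 hΛ' hlip₂ hVB₂ hVG₂

/-! ## §2. Two steps in coercivity units, with `t`-free side conditions -/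

/-- Real arithmetic: the `t`-free modulus condition `λ·Λ·ρ·d²∕γ ≤ c₂` IS the relative modulus letter of the rescaled step,
`|t|³Λ·(λρ∕|t|) ≤ c₂·(t²γ∕d²)`. [folklore] -/
theorem modulus_side_of_unit {t Λ lam ρ d γ c₂ : ℝ} (ht : t ≠ 0) (hγ : 0 < γ) (hd : 0 < d)
    (h : lam * Λ * ρ * d ^ 2 / γ ≤ c₂) : |t| ^ 3 * Λ * (lam * ρ / |t|) ≤ c₂ * (t ^ 2 * (γ / d ^ 2)) := by
  have ht' : 0 < |t| := abs_pos.mpr ht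
  have hd2 : 0 < d ^ 2 := by positivity
  have e1 : |t| ^ 3 * Λ * (lam * ρ / |t|) = t ^ 2 * (Λ * (lam * ρ)) := by
    rw [show t ^ 2 = |t| ^ 2 from (sq_abs t).symm]
    field_simp
  have h2 : Λ * (lam * ρ) ≤ c₂ * (γ / d ^ 2) := by
    have h3 : lam * Λ * ρ * d ^ 2 / γ * (γ / d ^ 2) ≤ c₂ * (γ / d ^ 2) :=
      mul_le_mul_of_nonneg_right h (div_pos hγ hd2).le
    have e2 : lam * Λ * ρ * d ^ 2 / γ * (γ / d ^ 2) = Λ * (lam * ρ) := by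
      field_simp
    linarith [e2 ▸ h3]
  rw [e1]
  have ht2 : 0 ≤ t ^ 2 := sq_nonneg t
  calc t ^ 2 * (Λ * (lam * ρ)) ≤ t ^ 2 * (c₂ * (γ / d ^ 2)) := mul_le_mul_of_nonneg_left h2 ht2
    _ = c₂ * (t ^ 2 * (γ / d ^ 2)) := by ring

/-- Real arithmetic: the radius `r₂ = λ·ρ∕|t|`, `0 < λ < 1`, `ρ > 0`, `t ≠ 0` ⟹ `0 < r₂ < ρ∕|t|`. [folklore] -/
theorem radius_side_of_unit {t lam ρ : ℝ} (ht : t ≠ 0) (hlam : 0 < lam) (hlam1 : lam < 1) (hρ : 0 < ρ) :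
    0 < lam * ρ / |t| ∧ lam * ρ / |t| < ρ / |t| := by
  have ht' : 0 < |t| := abs_pos.mpr ht
  exact ⟨div_pos (mul_pos hlam hρ) ht', div_lt_div_of_pos_right (by nlinarith) ht'⟩

variable [CompleteSpace E] [Nontrivial E]

/-- **TWO STEPS OF THE TOWER IN COERCIVITY UNITS — EVERY SIDE CONDITION `t`-FREE.**  Scale `k`: `inductiveStep_unit`'s hypotheses
VERBATIM (dimensionless `N`, relative modulus `c`, sizes `M₃, B, G`, kernel coercivity `m`); a homothety `t ≠ 0`; scale `k+1`: the
blocking `D₂` with right inverse `M₂`, TFC's two letters — the two-scale coercivity `m₂` of `V″(δ₀)` on `ker (D₂ ∘ D)` and the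
blocking size `‖Dv‖ ≤ d‖v‖` —, `N₂, c₂` with `c₂ < N₂⁻¹`, a radius FRACTION `0 < λ < 1`, and the two `t`-FREE side conditions of the
unit box (HSUB): `(1 + (B∕m)·K₁²·d²∕(m₂∕m))‖M₂‖ + 1 ≤ N₂` and `λ·Λ₃·(K₁⁻¹r)·d²∕(m₂∕m) ≤ c₂` with `K₁ = (N⁻¹ − c)⁻¹`,
`Λ₃ = (M₃∕m)K₁K₁²(1 + 2(B∕m)K₁)` ⟹ charts `σ₁`, `σ₂` (centres `δ₀`, `v₀ := t⁻¹ • Dδ₀`), `σ₂`'s chart letters on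
`ball (D₂v₀) ((N₂⁻¹ − c₂)·r₂)` with `r₂ := λ(K₁⁻¹r)∕|t|`, the first-order letter and FULL criticality of the twice-renormalised action
`((t²(m₂∕m)∕d²)⁻¹ • ((m⁻¹ • V) ∘ σ₁ ∘ (t•))) ∘ σ₂` at `D₂v₀`.  The homothety enters only the centre, the radius and the gradient
size — never a side condition. [folklore] -/
theorem twoSteps_unit (D : E →L[ℝ] F) (M : F →L[ℝ] E) (hM : ∀ w, D (M w) = w)
    {V : E → ℝ} {V'' : E → E →L[ℝ] E →L[ℝ] ℝ} {δ₀ : E} {m : ℝ} (hm : 0 < m)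
    (hco : ∀ κ, D κ = 0 → m * ‖κ‖ ^ 2 ≤ V'' δ₀ κ κ)
    {N c : ℝ≥0} (hN : (1 + ‖V'' δ₀‖ / m) * ‖M‖ + 1 ≤ (N : ℝ)) (hc : c < N⁻¹) {r : ℝ} (hr : 0 < r)
    (hVd : ∀ x ∈ closedBall δ₀ r, DifferentiableAt ℝ V x)
    (hV : ∀ x ∈ closedBall δ₀ r, HasFDerivAt (fderiv ℝ V) (V'' x) x)
    (hVc : ∀ x ∈ closedBall δ₀ r, ‖V'' x - V'' δ₀‖ ≤ c * m)
    (hcrit0 : fderiv ℝ V δ₀ = 0)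
    {M₃ B G : ℝ} (hM₃ : 0 ≤ M₃)
    (hV''lip : ∀ x ∈ closedBall δ₀ r, ∀ x' ∈ closedBall δ₀ r, ‖V'' x - V'' x'‖ ≤ M₃ * ‖x - x'‖)
    (hVB : ∀ x ∈ closedBall δ₀ r, ‖V'' x‖ ≤ B) (hVG : ∀ x ∈ closedBall δ₀ r, ‖fderiv ℝ V x‖ ≤ G)
    -- the rescaling
    {t : ℝ} (ht : t ≠ 0)
    -- scale k+1: blocking, TFC's two letters
    (D₂ : F →L[ℝ] F₂) (M₂ : F₂ →L[ℝ] F) (hM₂ : ∀ u, D₂ (M₂ u) = u)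
    {m₂ : ℝ} (hm₂ : 0 < m₂) (hco₂ : ∀ v, D₂ (D v) = 0 → m₂ * ‖v‖ ^ 2 ≤ V'' δ₀ v v)
    {d : ℝ} (hd0 : 0 < d) (hd : ∀ v, ‖D v‖ ≤ d * ‖v‖)
    {N₂ c₂ : ℝ≥0} (hc₂ : c₂ < N₂⁻¹)
    -- the two t-FREE side conditions of the unit box
    (hN₂ : (1 + B / m * (((N : ℝ)⁻¹ - c)⁻¹) ^ 2 * d ^ 2 / (m₂ / m)) * ‖M₂‖ + 1 ≤ (N₂ : ℝ))
    {lam : ℝ} (hlam : 0 < lam) (hlam1 : lam < 1)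
    (hc₂' : lam * (M₃ / m * ((N : ℝ)⁻¹ - c)⁻¹ * (((N : ℝ)⁻¹ - c)⁻¹) ^ 2 * (1 + 2 * (B / m) * ((N : ℝ)⁻¹ - c)⁻¹)) *
      (((N : ℝ)⁻¹ - c) * r) * d ^ 2 / (m₂ / m) ≤ (c₂ : ℝ)) :
    ∃ σ₁ : F → E, ∃ σ₂ : F₂ → F, σ₁ (D δ₀) = δ₀ ∧ σ₂ (D₂ (t⁻¹ • D δ₀)) = t⁻¹ • D δ₀ ∧
      (∀ u ∈ ball (D₂ (t⁻¹ • D δ₀)) (((N₂ : ℝ)⁻¹ - c₂) * (lam * (((N : ℝ)⁻¹ - c) * r) / |t|)),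
        σ₂ u ∈ closedBall (t⁻¹ • D δ₀) (lam * (((N : ℝ)⁻¹ - c) * r) / |t|) ∧
        DifferentiableAt ℝ σ₂ u ∧ (∀ k, D₂ (fderiv ℝ σ₂ u k) = k) ∧ ‖fderiv ℝ σ₂ u‖ ≤ ((N₂ : ℝ)⁻¹ - c₂)⁻¹) ∧
      (∀ u ∈ ball (D₂ (t⁻¹ • D δ₀)) (((N₂ : ℝ)⁻¹ - c₂) * (lam * (((N : ℝ)⁻¹ - c) * r) / |t|)),
        DifferentiableAt ℝ (((t ^ 2 * ((m₂ / m) / d ^ 2))⁻¹ • fun v : F => ((m⁻¹ • V) ∘ σ₁) (t • v)) ∘ σ₂) u ∧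
        ‖fderiv ℝ (((t ^ 2 * ((m₂ / m) / d ^ 2))⁻¹ • fun v : F => ((m⁻¹ • V) ∘ σ₁) (t • v)) ∘ σ₂) u‖ ≤
          |t| * (G / m * ((N : ℝ)⁻¹ - c)⁻¹) / (t ^ 2 * ((m₂ / m) / d ^ 2)) * ((N₂ : ℝ)⁻¹ - c₂)⁻¹) ∧
      fderiv ℝ (((t ^ 2 * ((m₂ / m) / d ^ 2))⁻¹ • fun v : F => ((m⁻¹ • V) ∘ σ₁) (t • v)) ∘ σ₂) (D₂ (t⁻¹ • D δ₀)) = 0 := by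
  -- step k in coercivity units
  obtain ⟨σ₁, hσ0, ha, ha', hb, hb', hcc, hcc', hdd⟩ :=
    HardStepUnitStep.inductiveStep_unit D M hM hm hco hN hc hr hVd hV hVc hcrit0 hM₃ hV''lip hVB hVG
  have hP : 0 < (N : ℝ)⁻¹ - c := sub_pos.mpr (by exact_mod_cast hc)
  have hρ : 0 < ((N : ℝ)⁻¹ - c) * r := mul_pos hP hr
  have hK : 0 < ((N : ℝ)⁻¹ - c)⁻¹ := inv_pos.mpr hP
  have hBm : 0 ≤ B / m := div_nonneg ((norm_nonneg (V'' δ₀)).trans (hVB δ₀ (mem_closedBall_self hr.le))) hm.le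
  have hM₃m : 0 ≤ M₃ / m := div_nonneg hM₃ hm.le
  have hΛ₃ : 0 ≤ M₃ / m * ((N : ℝ)⁻¹ - c)⁻¹ * (((N : ℝ)⁻¹ - c)⁻¹) ^ 2 * (1 + 2 * (B / m) * ((N : ℝ)⁻¹ - c)⁻¹) := by
    positivity
  -- the next coercivity `t²·(m₂∕m)∕d²` from TFC's letter, read for the normalised Hessian `m⁻¹ • V″(δ₀)`
  have hγ : 0 < m₂ / m := div_pos hm₂ hm
  have hco₂n : ∀ v, D₂ (D v) = 0 → m₂ / m * ‖v‖ ^ 2 ≤ (m⁻¹ • V'' δ₀) v v := by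
    intro v hv
    have h1 := hco₂ v hv
    change m₂ / m * ‖v‖ ^ 2 ≤ m⁻¹ * V'' δ₀ v v
    rw [div_eq_mul_inv, mul_comm m₂, mul_assoc]
    exact mul_le_mul_of_nonneg_left h1 (inv_pos.mpr hm).le
  have ht2 : 0 < t ^ 2 := by positivity
  have hm₂' : 0 < t ^ 2 * ((m₂ / m) / d ^ 2) := mul_pos ht2 (div_pos hγ (by positivity))
  have hw0 : D δ₀ ∈ ball (D δ₀) (((N : ℝ)⁻¹ - c) * r) := mem_ball_self hρ
  have hco₂' : ∀ κ, D₂ κ = 0 → t ^ 2 * ((m₂ / m) / d ^ 2) * ‖κ‖ ^ 2 ≤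
      ((t ^ 2) • (m⁻¹ • V'' (σ₁ (D δ₀))).bilinearComp (fderiv ℝ σ₁ (D δ₀)) (fderiv ℝ σ₁ (D δ₀))) κ κ := by
    intro κ hκ
    rw [hσ0]
    have h := TransportedFormCoercivity.kerCoercive_bilinearComp_div (Q := m⁻¹ • V'' δ₀) (ha _ hw0).2.2.1 D₂ hγ.le hco₂n
      hd0 hd κ hκ
    rw [smul_apply, smul_apply, smul_eq_mul, mul_assoc]
    exact mul_le_mul_of_nonneg_left h ht2.le
  -- the two side conditions in the rescaled step's shapes
  have hN₂' : (1 + t ^ 2 * (B / m * (((N : ℝ)⁻¹ - c)⁻¹) ^ 2) / (t ^ 2 * ((m₂ / m) / d ^ 2))) * ‖M₂‖ + 1 ≤ (N₂ : ℝ) := by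
    rw [ActionScalingLetters.nextHessianSize_unit ht]; exact hN₂
  obtain ⟨hr₂, hr₂ρ⟩ := radius_side_of_unit ht hlam hlam1 hρ
  have hc₂r : |t| ^ 3 * (M₃ / m * ((N : ℝ)⁻¹ - c)⁻¹ * (((N : ℝ)⁻¹ - c)⁻¹) ^ 2 * (1 + 2 * (B / m) * ((N : ℝ)⁻¹ - c)⁻¹)) *
      (lam * (((N : ℝ)⁻¹ - c) * r) / |t|) ≤ (c₂ : ℝ) * (t ^ 2 * ((m₂ / m) / d ^ 2)) :=
    modulus_side_of_unit ht hγ hd0 hc₂'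
  -- step k+1 through §1
  obtain ⟨σ₂, h20, h2a, -, h2b, -, -, -, h2d⟩ :=
    nextStep_of_letters_unit (U := (m⁻¹ • V) ∘ σ₁)
      (U'' := fun w => (m⁻¹ • V'' (σ₁ w)).bilinearComp (fderiv ℝ σ₁ w) (fderiv ℝ σ₁ w)) D ht hρ ha ha' hb hb' hcc hcc' hdd hΛ₃
      D₂ M₂ hM₂ hm₂' hco₂' hN₂' hc₂ hr₂ hr₂ρ hc₂r
  exact ⟨σ₁, σ₂, hσ0, h20, h2a, h2b, h2d⟩

/-! ## §3. The same `(N, c)` serve: the junction with the unit box -/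

/-- Real arithmetic: HSUB's modulus product IS §2's `t`-free modulus hypothesis (`P = K₁⁻¹`). [folklore] -/
theorem modulus_hyp_of_box {xM xB P d γ lam r c : ℝ} (hP : 0 < P)
    (h : lam * (1 + 2 * xB * P⁻¹) * (xM * r) * ((P⁻¹) ^ 2 * d ^ 2 / γ) ≤ c) :
    lam * (xM * P⁻¹ * (P⁻¹) ^ 2 * (1 + 2 * xB * P⁻¹)) * (P * r) * d ^ 2 / γ ≤ c := by
  have e : lam * (xM * P⁻¹ * (P⁻¹) ^ 2 * (1 + 2 * xB * P⁻¹)) * (P * r) * d ^ 2 / γ =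
      lam * (1 + 2 * xB * P⁻¹) * (xM * r) * ((P⁻¹) ^ 2 * d ^ 2 / γ) := by
    field_simp
  rw [e]; exact h

/-- **TWO STEPS WITH THE SAME `(N, c)` UNDER THE UNIT BOX.**  `twoSteps_unit`'s data with `(N₂, c₂) := (N, c)`, the side conditions
REPLACED by HSUB's `t`-free box: `Θ := K₁²d²∕γ ≤ 1`, `λ(1 + 2(B∕m)K₁)Θ ≤ 1` (`γ = m₂∕m`, `K₁ = (N⁻¹ − c)⁻¹`), the carried equivalence
letter `(1 + B∕m)μ + 1 ≤ N` with `‖M₂‖ ≤ μ`, and the carried modulus letter `(M₃∕m)·r ≤ c` ⟹ `twoSteps_unit`'s conclusion with the SAME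
`N` and `c` at scale `k+1` (HSUB `nextEquiv_le` ∕ `nextXB_le` ∕ `nextModulusLetter_le` BY NAME).  No `t` in any hypothesis except
`t ≠ 0`.  HONEST (v1.2, the pricing desk's located price [NE7bREF-G97-LOCUS2-WORD], kernel twin HSUB v1.1 §6
`not_box_of_chartLetter`): this theorem is TRUE AND EMPTY on every non-trivial blocking — its own binders give `K₁ = (N⁻¹ − c)⁻¹ ≥ N
≥ (1 + B∕m)‖M‖ + 1`, `‖M‖‖D‖ ≥ 1` and `m₂∕m ≤ B∕m` on `ker (D₂∘D) ≠ 0`, whence `Θ ≥ 4`, contradicting `hΘ`; it records the SHAPE of a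
closing step, and locates the debt in the CHART letter (AHE's global equivalence bound feeding `K₁`). [folklore] -/
theorem twoSteps_unit_of_box (D : E →L[ℝ] F) (M : F →L[ℝ] E) (hM : ∀ w, D (M w) = w)
    {V : E → ℝ} {V'' : E → E →L[ℝ] E →L[ℝ] ℝ} {δ₀ : E} {m : ℝ} (hm : 0 < m)
    (hco : ∀ κ, D κ = 0 → m * ‖κ‖ ^ 2 ≤ V'' δ₀ κ κ)
    {N c : ℝ≥0} (hN : (1 + ‖V'' δ₀‖ / m) * ‖M‖ + 1 ≤ (N : ℝ)) (hc : c < N⁻¹) {r : ℝ} (hr : 0 < r)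
    (hVd : ∀ x ∈ closedBall δ₀ r, DifferentiableAt ℝ V x)
    (hV : ∀ x ∈ closedBall δ₀ r, HasFDerivAt (fderiv ℝ V) (V'' x) x)
    (hVc : ∀ x ∈ closedBall δ₀ r, ‖V'' x - V'' δ₀‖ ≤ c * m)
    (hcrit0 : fderiv ℝ V δ₀ = 0)
    {M₃ B G : ℝ} (hM₃ : 0 ≤ M₃)
    (hV''lip : ∀ x ∈ closedBall δ₀ r, ∀ x' ∈ closedBall δ₀ r, ‖V'' x - V'' x'‖ ≤ M₃ * ‖x - x'‖)
    (hVB : ∀ x ∈ closedBall δ₀ r, ‖V'' x‖ ≤ B) (hVG : ∀ x ∈ closedBall δ₀ r, ‖fderiv ℝ V x‖ ≤ G)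
    {t : ℝ} (ht : t ≠ 0)
    (D₂ : F →L[ℝ] F₂) (M₂ : F₂ →L[ℝ] F) (hM₂ : ∀ u, D₂ (M₂ u) = u)
    {m₂ : ℝ} (hm₂ : 0 < m₂) (hco₂ : ∀ v, D₂ (D v) = 0 → m₂ * ‖v‖ ^ 2 ≤ V'' δ₀ v v)
    {d : ℝ} (hd0 : 0 < d) (hd : ∀ v, ‖D v‖ ≤ d * ‖v‖)
    {lam : ℝ} (hlam : 0 < lam) (hlam1 : lam < 1)
    -- the unit box (HSUB): two Θ-inequalities and the two carried letters
    (hΘ : (((N : ℝ)⁻¹ - c)⁻¹) ^ 2 * d ^ 2 / (m₂ / m) ≤ 1)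
    (hΘM : lam * (1 + 2 * (B / m) * ((N : ℝ)⁻¹ - c)⁻¹) * ((((N : ℝ)⁻¹ - c)⁻¹) ^ 2 * d ^ 2 / (m₂ / m)) ≤ 1)
    {μ : ℝ} (hμ : ‖M₂‖ ≤ μ) (hNbox : (1 + B / m) * μ + 1 ≤ (N : ℝ)) (hcbox : M₃ / m * r ≤ (c : ℝ)) :
    ∃ σ₁ : F → E, ∃ σ₂ : F₂ → F, σ₁ (D δ₀) = δ₀ ∧ σ₂ (D₂ (t⁻¹ • D δ₀)) = t⁻¹ • D δ₀ ∧
      (∀ u ∈ ball (D₂ (t⁻¹ • D δ₀)) (((N : ℝ)⁻¹ - c) * (lam * (((N : ℝ)⁻¹ - c) * r) / |t|)),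
        σ₂ u ∈ closedBall (t⁻¹ • D δ₀) (lam * (((N : ℝ)⁻¹ - c) * r) / |t|) ∧
        DifferentiableAt ℝ σ₂ u ∧ (∀ k, D₂ (fderiv ℝ σ₂ u k) = k) ∧ ‖fderiv ℝ σ₂ u‖ ≤ ((N : ℝ)⁻¹ - c)⁻¹) ∧
      (∀ u ∈ ball (D₂ (t⁻¹ • D δ₀)) (((N : ℝ)⁻¹ - c) * (lam * (((N : ℝ)⁻¹ - c) * r) / |t|)),
        DifferentiableAt ℝ (((t ^ 2 * ((m₂ / m) / d ^ 2))⁻¹ • fun v : F => ((m⁻¹ • V) ∘ σ₁) (t • v)) ∘ σ₂) u ∧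
        ‖fderiv ℝ (((t ^ 2 * ((m₂ / m) / d ^ 2))⁻¹ • fun v : F => ((m⁻¹ • V) ∘ σ₁) (t • v)) ∘ σ₂) u‖ ≤
          |t| * (G / m * ((N : ℝ)⁻¹ - c)⁻¹) / (t ^ 2 * ((m₂ / m) / d ^ 2)) * ((N : ℝ)⁻¹ - c)⁻¹) ∧
      fderiv ℝ (((t ^ 2 * ((m₂ / m) / d ^ 2))⁻¹ • fun v : F => ((m⁻¹ • V) ∘ σ₁) (t • v)) ∘ σ₂) (D₂ (t⁻¹ • D δ₀)) = 0 := by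
  have hP : 0 < (N : ℝ)⁻¹ - c := sub_pos.mpr (by exact_mod_cast hc)
  have hxB : 0 ≤ B / m := div_nonneg ((norm_nonneg (V'' δ₀)).trans (hVB δ₀ (mem_closedBall_self hr.le))) hm.le
  have hxMr : 0 ≤ M₃ / m * r := mul_nonneg (div_nonneg hM₃ hm.le) hr.le
  have hΘ0 : 0 ≤ (((N : ℝ)⁻¹ - c)⁻¹) ^ 2 * d ^ 2 / (m₂ / m) := by
    have hγ : 0 < m₂ / m := div_pos hm₂ hm
    positivity
  -- HSUB: the same N and the same c
  have hxB' := HardStepUnitBox.nextXB_le hxB hΘ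
  have hxB'0 : 0 ≤ B / m * (((N : ℝ)⁻¹ - c)⁻¹) ^ 2 * d ^ 2 / (m₂ / m) := by
    have e : B / m * (((N : ℝ)⁻¹ - c)⁻¹) ^ 2 * d ^ 2 / (m₂ / m) = B / m * ((((N : ℝ)⁻¹ - c)⁻¹) ^ 2 * d ^ 2 / (m₂ / m)) := by
      ring
    rw [e]; exact mul_nonneg hxB hΘ0
  have hN₂ : (1 + B / m * (((N : ℝ)⁻¹ - c)⁻¹) ^ 2 * d ^ 2 / (m₂ / m)) * ‖M₂‖ + 1 ≤ (N : ℝ) :=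
    HardStepUnitBox.nextEquiv_le hxB'0 hxB' (norm_nonneg _) hμ hNbox
  have hc₂' : lam * (M₃ / m * ((N : ℝ)⁻¹ - c)⁻¹ * (((N : ℝ)⁻¹ - c)⁻¹) ^ 2 * (1 + 2 * (B / m) * ((N : ℝ)⁻¹ - c)⁻¹)) *
      (((N : ℝ)⁻¹ - c) * r) * d ^ 2 / (m₂ / m) ≤ (c : ℝ) :=
    modulus_hyp_of_box hP (HardStepUnitBox.nextModulusLetter_le hxMr hcbox hΘM)
  exact twoSteps_unit D M hM hm hco hN hc hr hVd hV hVc hcrit0 hM₃ hV''lip hVB hVG ht D₂ M₂ hM₂ hm₂ hco₂ hd0 hd hc hN₂ hlam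
    hlam1 hc₂'

end Summit.QuantumFields.BalabanUV.T4Continuum.NE7b.HardStepUnitTower

end
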